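import Summits.ValiantsHypothesis.ValiantsHypothesis.Theorems.LacunarySymmetroidMatrixDescartesDoorA26WallBubblingMixedNoBalance

/-!
# `DoorA26` / line `wall_bubbling` — MIXED LIFT: every honestly encoded touch profile with rank-one touches AND rank-zero nodes lifts

HONEST FRAMING.  Object-search cell `pub-symmetroid`, crux `Theses.LacunarySymmetroid.DoorA26` (stmt-ValiantsHypothesis-19979; OPEN, typed,
never asserted).  W2 seat val-sym-door-p1 g19; def-free helper for obligation (R) of `Cruxes/DoorA26/Lines/wall_bubbling.lean`.  File #62 of
the MIXED chain #58–#63.  Imports #61 `…MixedNoBalance`.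

WHAT IS HERE.  `card_nodes_le_five` (six vanishing abscissae kill every letter), `det_add_sub_sub_eq` (polarisation in shift coordinates, pointwise form of
#47 `polar_coordShift`), ★★ `mem_twentyLocus_of_mixed_touches`: strictly increasing `δ`, `τ`, symmetric letters, alternating `κ`, honest encoding of
`J`, nodes `J₀ ⊆ J` with `P(τ_i) = 0`, rank-one touches on `J ∖ J₀`, `0 < κ_j det P(τ_j)` off `J` ⇒ `δ ∈ TwentyLocus`.  PROOF: choose six interpolation
abscissae `⊇ J₀` and exponential interpolants `φ_m` (#45); GORDAN (#47 `gordan`) over shift pencils `Q′ = Σ_m φ_m ⊗ W_m` on the NON-node interpolants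
(these vanish at the nodes) with the push functionals of the rank-one touches: the balanced alternative is a restricted balance, excluded by #61; the
feasible one gives `Q′` with `κ_j·polar(P,Q′)(τ_j) > 0` on `J ∖ J₀` and `Q′(τ_i) = 0` on `J₀`; add `Q₀ = Σ_(node m) φ_m ⊗ diag(1, κ_i)` (so `det Q₀(τ_i) = κ_i`)
and take `Q = Q₀ + λQ′` with `λ` large; then #46 `mem_twentyLocus_of_touches_alternations_pencilShift` with its SECOND-ORDER clause at the nodes
(`det P = 0`, `polar = 0`, `0 < κ_i det Q(τ_i) = κ_i²`).  Nothing here bears on `DoorA26`, `DoorA34`, (W)/(M)/(R) as typed, `MatrixDescartes` (18050) or `VP ≠ VNP`; registers unchanged.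

[folklore] Gordan/Motzkin alternative via interpolation coordinates.  [this work] the construction.
-/

set_option linter.dupNamespace false

namespace Summit.ValiantsHypothesis.ValiantsHypothesis.Theorems.LacunarySymmetroidMatrixDescartes.WallBubbling

open Finset Filter Topology
open Bubbling (TwentyLocus polar polar_apply polar_comm polar_self expSum)

/-- At most five abscissae can be rank-zero nodes (else every letter vanishes and `det P ≡ 0`). [folklore] -/
theorem card_nodes_le_five (δ : Fin 6 → ℝ) (hd : StrictMono δ) (S : Fin 6 → Matrix (Fin 2) (Fin 2) ℝ)
    (τ : Fin 21 → ℝ) (hτ : StrictMono τ) (J₀ : Finset (Fin 21))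
    (hnode : ∀ i ∈ J₀, (∑ l, Real.exp (δ l * τ i) • S l) = 0) (j₀ : Fin 21)
    (hj₀ : (∑ l, Real.exp (δ l * τ j₀) • S l).det ≠ 0) : J₀.card ≤ 5 := by
  classical
  by_contra hlt
  obtain ⟨T6, hT6, hcard⟩ := Finset.exists_subset_card_eq (show 6 ≤ J₀.card by omega)
  let z : Fin 6 → ℝ := fun i => τ (T6.orderEmbOfFin hcard i)
  have hz : Function.Injective z := hτ.injective.comp (T6.orderEmbOfFin hcard).injective
  have hS0 : ∀ l (a b : Fin 2), S l a b = 0 := by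
    intro l a b
    have := expCoeff_eq_zero_of_zeros δ hd.injective z hz (fun l => S l a b) (fun m => by
      have h := hnode _ (hT6 (T6.orderEmbOfFin_mem hcard m))
      have := congrFun (congrFun h a) b
      rw [Matrix.sum_apply] at this
      simp only [Matrix.smul_apply, smul_eq_mul, Matrix.zero_apply] at this
      rw [← this]; exact Finset.sum_congr rfl fun l _ => by ring)
    exact congrFun this l
  apply hj₀
  have : (∑ l, Real.exp (δ l * τ j₀) • S l) = 0 := by
    ext a b
    rw [Matrix.sum_apply]
    simp [Matrix.smul_apply, hS0]
  rw [this]; exact Matrix.det_zero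

/-- Polarisation in shift coordinates (as in #47 `polar_coordShift`, pointwise): for symmetric `P`, `Q`,
`det(P+Q) − det P − det Q = P₁₁ Q₀₀ − (P₀₁+P₁₀) Q₀₁ + P₀₀ Q₁₁`. [folklore] -/
theorem det_add_sub_sub_eq (P Q : Matrix (Fin 2) (Fin 2) ℝ) (hQ : Q 1 0 = Q 0 1) :
    (P + Q).det - P.det - Q.det = P 1 1 * Q 0 0 - (P 0 1 + P 1 0) * Q 0 1 + P 0 0 * Q 1 1 := by
  simp only [Matrix.det_fin_two, Matrix.add_apply]; rw [hQ]; ring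

/-- **MIXED LIFT: every honestly encoded touch profile with rank-one touches and rank-zero NODES lifts.**  Strictly increasing
exponents and abscissae, symmetric letters, alternating `κ`, an honestly encoded touch set `J` (`0, 20 ∉ J`, no two adjacent indices), a
subset `J₀ ⊆ J` of NODES where the pencil VANISHES, rank-one touches on `J ∖ J₀` (`det = 0 ≠ tr`), `0 < κ_j det P(τ_j)` off `J`.  Then
`δ ∈ TwentyLocus`.  Proof: Gordan over the shift pencils vanishing at the nodes (parametrised by exponential interpolants); the balance
alternative is excluded by `noRestrictedBalance`; the feasible alternative gives `Q′` with the right first-order pushes at the rank-one touches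
and `Q′ = 0` at the nodes; add an interpolated `Q₀` with `det Q₀(τ_i) = κ_i` at the nodes and scale `Q′` up; then #46's Q-lift with its
second-order clause at the nodes. [this work] -/
theorem mem_twentyLocus_of_mixed_touches (δ : Fin 6 → ℝ) (hd : StrictMono δ) (S : Fin 6 → Matrix (Fin 2) (Fin 2) ℝ)
    (hS : ∀ l, (S l).IsSymm) (τ : Fin 21 → ℝ) (hτ : StrictMono τ) (κ : Fin 21 → ℝ) (J J₀ : Finset (Fin 21)) (hJ₀ : J₀ ⊆ J)
    (hoff : ∀ j ∉ J, 0 < κ j * (∑ l, Real.exp (δ l * τ j) • S l).det)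
    (hon : ∀ j ∈ J, j ∉ J₀ → (∑ l, Real.exp (δ l * τ j) • S l).det = 0 ∧ (∑ l, Real.exp (δ l * τ j) • S l).trace ≠ 0)
    (hnode : ∀ i ∈ J₀, (∑ l, Real.exp (δ l * τ i) • S l) = 0)
    (halt : ∀ j : Fin 20, κ j.castSucc * κ j.succ < 0)
    (h0 : (0 : Fin 21) ∉ J) (h20 : Fin.last 20 ∉ J) (hsep : ∀ j : Fin 20, j.castSucc ∈ J → j.succ ∉ J) :
    δ ∈ TwentyLocus := by
  classical
  set P : Fin 21 → Matrix (Fin 2) (Fin 2) ℝ := fun j => ∑ l', Real.exp (δ l' * τ j) • S l' with hP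
  have hPsym : ∀ j, (P j) 1 0 = (P j) 0 1 := fun j => (isSymm_expPencil δ S hS (τ j)).apply 0 1
  have hκ : ∀ j, κ j ≠ 0 := by
    intro j hz
    rcases Fin.eq_castSucc_or_eq_last j with ⟨m, hm⟩ | hlast
    · have := halt m; rw [← hm, hz, zero_mul] at this; exact lt_irrefl _ this
    · have := halt (Fin.last 19); rw [Fin.succ_last, ← hlast, hz, mul_zero] at this; exact lt_irrefl _ this
  have hdet0 : (P 0).det ≠ 0 := by
    intro hz; have := hoff 0 h0; rw [show (∑ l, Real.exp (δ l * τ 0) • S l).det = (P 0).det from rfl, hz,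
      mul_zero] at this; exact lt_irrefl _ this
  -- six interpolation abscissae containing the nodes
  have hn5 : J₀.card ≤ 5 := card_nodes_le_five δ hd S τ hτ J₀ hnode 0 hdet0
  obtain ⟨Tc, hTc, hTcard⟩ := Finset.exists_subset_card_eq
    (show 6 - J₀.card ≤ (Finset.univ \ J₀).card by
      rw [Finset.card_univ_sdiff, Fintype.card_fin]; omega)
  set I₆ : Finset (Fin 21) := J₀ ∪ Tc with hI₆
  have hdisjT : Disjoint J₀ Tc := Finset.disjoint_left.2 fun i hi hi' => (Finset.mem_sdiff.1 (hTc hi')).2 hi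
  have h6 : I₆.card = 6 := by rw [hI₆, Finset.card_union_of_disjoint hdisjT, hTcard]; omega
  set e6 : Fin 6 ↪o Fin 21 := I₆.orderEmbOfFin h6 with he6
  have he6mem : ∀ m, e6 m ∈ I₆ := fun m => I₆.orderEmbOfFin_mem h6 m
  have he6surj : ∀ i ∈ I₆, ∃ m, e6 m = i := fun i hi => by
    have : i ∈ Set.range e6 := by rw [he6, Finset.range_orderEmbOfFin]; exact hi
    exact this
  set t : Fin 6 → ℝ := fun m => τ (e6 m) with ht
  have htinj : Function.Injective t := hτ.injective.comp e6.injective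
  -- exponential interpolants `φ_m` with `φ_m(t_i) = [i = m]`
  have hC : ∀ m : Fin 6, ∃ c : Fin 6 → ℝ, ∀ i, ∑ l, c l * Real.exp (δ l * t i) = if i = m then 1 else 0 :=
    fun m => exists_expSum_interpolate δ hd.injective t htinj _
  choose C hCval using hC
  -- value of `φ_m` at a node abscissa
  have hCnode : ∀ i ∈ J₀, ∀ m, ∑ l, C m l * Real.exp (δ l * τ i) = if e6 m = i then 1 else 0 := by
    intro i hi m
    obtain ⟨m₀, rfl⟩ := he6surj i (Finset.mem_union_left _ hi)
    rw [show τ (e6 m₀) = t m₀ from rfl, hCval m m₀]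
    by_cases h : m₀ = m
    · subst h; simp
    · rw [if_neg h, if_neg (fun h' => h (e6.injective h').symm)]
  -- Gordan over shift pencils vanishing at the nodes
  set Jr : Finset (Fin 21) := J.filter fun j => j ∉ J₀ with hJr
  have hmemJr : ∀ j, j ∈ Jr ↔ j ∈ J ∧ j ∉ J₀ := fun j => by simp [hJr]
  let c3 : Fin 21 → Fin 3 → ℝ := fun j => ![(P j) 1 1, -((P j) 0 1 + (P j) 1 0), (P j) 0 0]
  let V : Jr → (Fin 6 × Fin 3 → ℝ) := fun j me =>
    if e6 me.1 ∈ J₀ then 0 else κ j * (∑ l, C me.1 l * Real.exp (δ l * τ j)) * c3 j me.2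
  rcases gordan V with ⟨q, hq⟩ | ⟨μ, hμ0, hμ1, hμV⟩
  · -- FEASIBLE: build the shift pencil
    let W : Fin 6 → Matrix (Fin 2) (Fin 2) ℝ := fun m => !![q (m, 0), q (m, 1); q (m, 1), q (m, 2)]
    let sN : Fin 21 → Matrix (Fin 2) (Fin 2) ℝ := fun i => !![1, 0; 0, κ i]
    let T' : Fin 6 → Matrix (Fin 2) (Fin 2) ℝ := fun l => ∑ m, (if e6 m ∈ J₀ then (0 : ℝ) else C m l) • W m
    let T₀ : Fin 6 → Matrix (Fin 2) (Fin 2) ℝ := fun l => ∑ m, (if e6 m ∈ J₀ then C m l else 0) • sN (e6 m)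
    -- evaluating the shift pencils
    have hevalT' : ∀ x, (∑ l, Real.exp (δ l * x) • T' l) =
        ∑ m, (if e6 m ∈ J₀ then (0 : ℝ) else ∑ l, C m l * Real.exp (δ l * x)) • W m := by
      intro x
      simp only [T', Finset.smul_sum, smul_smul]
      rw [Finset.sum_comm]
      refine Finset.sum_congr rfl fun m _ => ?_
      rw [← Finset.sum_smul]
      congr 1
      split_ifs with h
      · simp
      · exact Finset.sum_congr rfl fun l _ => by ring
    have hevalT₀ : ∀ x, (∑ l, Real.exp (δ l * x) • T₀ l) =
        ∑ m, (if e6 m ∈ J₀ then ∑ l, C m l * Real.exp (δ l * x) else 0) • sN (e6 m) := by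
      intro x
      simp only [T₀, Finset.smul_sum, smul_smul]
      rw [Finset.sum_comm]
      refine Finset.sum_congr rfl fun m _ => ?_
      rw [← Finset.sum_smul]
      congr 1
      split_ifs with h
      · exact Finset.sum_congr rfl fun l _ => by ring
      · simp
    -- at a node: `Q' = 0`, `Q₀ = sN`
    have hT'node : ∀ i ∈ J₀, (∑ l, Real.exp (δ l * τ i) • T' l) = 0 := by
      intro i hi
      rw [hevalT']
      refine Finset.sum_eq_zero fun m _ => ?_
      split_ifs with h
      · exact zero_smul _ _
      · rw [hCnode i hi m, if_neg (fun h' => h (by rw [h']; exact hi)), zero_smul]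
    have hT₀node : ∀ i ∈ J₀, (∑ l, Real.exp (δ l * τ i) • T₀ l) = sN i := by
      intro i hi
      rw [hevalT₀]
      obtain ⟨m₀, rfl⟩ := he6surj i (Finset.mem_union_left _ hi)
      rw [Finset.sum_eq_single m₀]
      · rw [if_pos hi, hCnode _ hi, if_pos rfl, one_smul]
      · intro m _ hm
        split_ifs with h
        · rw [hCnode _ hi, if_neg (fun h' => hm (e6.injective h')), zero_smul]
        · exact zero_smul _ _
      · intro h; exact absurd (Finset.mem_univ _) h
    -- at a rank-one touch: the first-order push of `Q'` is the Gordan functional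
    have hT'push : ∀ j (hj : j ∈ Jr), κ j * ((P j + ∑ l, Real.exp (δ l * τ j) • T' l).det - (P j).det -
        (∑ l, Real.exp (δ l * τ j) • T' l).det) = ∑ me, V ⟨j, hj⟩ me * q me := by
      intro j hj
      have hsymQ : (∑ l, Real.exp (δ l * τ j) • T' l) 1 0 = (∑ l, Real.exp (δ l * τ j) • T' l) 0 1 := by
        rw [hevalT']
        simp only [Matrix.sum_apply, Matrix.smul_apply, smul_eq_mul, W, Matrix.of_apply, Matrix.cons_val',
          Matrix.cons_val_zero, Matrix.cons_val_one, Matrix.empty_val', Matrix.cons_val_fin_one]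
      rw [det_add_sub_sub_eq _ _ hsymQ, hevalT']
      simp only [Matrix.sum_apply, Matrix.smul_apply, smul_eq_mul, W, Matrix.of_apply, Matrix.cons_val',
        Matrix.cons_val_zero, Matrix.cons_val_one, Matrix.empty_val', Matrix.cons_val_fin_one]
      rw [Finset.mul_sum, Finset.mul_sum, Finset.mul_sum, ← Finset.sum_sub_distrib, ← Finset.sum_add_distrib,
        Finset.mul_sum, Fintype.sum_prod_type]
      refine Finset.sum_congr rfl fun m _ => ?_
      simp only [V, Fin.sum_univ_three, c3, Matrix.cons_val_zero, Matrix.cons_val_one, Matrix.cons_val_two,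
        Matrix.head_cons, Matrix.tail_cons]
      split_ifs with h <;> ring
    -- scale
    let aj : Fin 21 → ℝ := fun j => if hj : j ∈ Jr then ∑ me, V ⟨j, hj⟩ me * q me else 1
    let bj : Fin 21 → ℝ := fun j => κ j * ((P j + ∑ l, Real.exp (δ l * τ j) • T₀ l).det - (P j).det -
        (∑ l, Real.exp (δ l * τ j) • T₀ l).det)
    have hajpos : ∀ j, 0 < aj j := by
      intro j; simp only [aj]; split_ifs with hj
      · exact hq ⟨j, hj⟩
      · exact one_pos
    set lam : ℝ := 1 + ∑ j, |bj j| / aj j with hlam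
    have hlam_big : ∀ j, 0 < bj j + lam * aj j := by
      intro j
      have h1 : |bj j| / aj j ≤ ∑ j', |bj j'| / aj j' :=
        Finset.single_le_sum (fun j' _ => div_nonneg (abs_nonneg _) (hajpos j').le) (Finset.mem_univ j)
      have h2 : |bj j| = |bj j| / aj j * aj j := (div_mul_cancel₀ _ (hajpos j).ne').symm
      have h3 : -bj j ≤ |bj j| := neg_le_abs _
      have h4 : |bj j| ≤ (∑ j', |bj j'| / aj j') * aj j := by
        rw [h2]; exact mul_le_mul_of_nonneg_right h1 (hajpos j).le
      have h5 : lam * aj j = aj j + (∑ j', |bj j'| / aj j') * aj j := by rw [hlam]; ring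
      linarith [hajpos j]
    let T : Fin 6 → Matrix (Fin 2) (Fin 2) ℝ := fun l => T₀ l + lam • T' l
    have hTsym : ∀ l, (T l).IsSymm := by
      intro l
      apply Matrix.IsSymm.ext; intro a b
      simp only [T, T₀, T', Matrix.add_apply, Matrix.smul_apply, Matrix.sum_apply, smul_eq_mul, W, sN]
      fin_cases a <;> fin_cases b <;> simp
    have hevalT : ∀ x, (∑ l, Real.exp (δ l * x) • T l) =
        (∑ l, Real.exp (δ l * x) • T₀ l) + lam • (∑ l, Real.exp (δ l * x) • T' l) := by
      intro x
      simp only [T, smul_add, Finset.sum_add_distrib, Finset.smul_sum, smul_smul, mul_comm lam]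
    refine mem_twentyLocus_of_touches_alternations_pencilShift δ S T hS hTsym τ hτ κ ?_ halt
    intro j
    by_cases hjJ : j ∈ J
    · by_cases hjN : j ∈ J₀
      · -- node: second-order clause
        right; right
        have hPj : P j = 0 := hnode j hjN
        have hQ : (∑ l, Real.exp (δ l * τ j) • T l) = sN j := by
          rw [hevalT, hT₀node j hjN, hT'node j hjN, smul_zero, add_zero]
        have hdz : (0 : Matrix (Fin 2) (Fin 2) ℝ).det = 0 := Matrix.det_zero
        refine ⟨by rw [show (∑ l, Real.exp (δ l * τ j) • S l) = P j from rfl, hPj, hdz], ?_, ?_⟩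
        · rw [show (∑ l, Real.exp (δ l * τ j) • S l) = P j from rfl, hPj, zero_add, hdz]; ring
        · rw [hQ]
          simp only [sN, Matrix.det_fin_two, Matrix.of_apply, Matrix.cons_val', Matrix.cons_val_zero,
            Matrix.cons_val_one, Matrix.empty_val', Matrix.cons_val_fin_one]
          nlinarith [mul_self_pos.2 (hκ j)]
      · -- rank-one touch: first-order clause
        right; left
        have hjr : j ∈ Jr := (hmemJr j).2 ⟨hjJ, hjN⟩
        refine ⟨(hon j hjJ hjN).1, ?_⟩
        show 0 < κ j * ((P j + ∑ l, Real.exp (δ l * τ j) • T l).det - (P j).det - (∑ l, Real.exp (δ l * τ j) • T l).det)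
        have hsym0 : (∑ l, Real.exp (δ l * τ j) • T₀ l) 1 0 = (∑ l, Real.exp (δ l * τ j) • T₀ l) 0 1 := by
          rw [hevalT₀]
          simp only [Matrix.sum_apply, Matrix.smul_apply, smul_eq_mul, sN, Matrix.of_apply, Matrix.cons_val',
            Matrix.cons_val_zero, Matrix.cons_val_one, Matrix.empty_val', Matrix.cons_val_fin_one]
        have hsym' : (∑ l, Real.exp (δ l * τ j) • T' l) 1 0 = (∑ l, Real.exp (δ l * τ j) • T' l) 0 1 := by
          rw [hevalT']
          simp only [Matrix.sum_apply, Matrix.smul_apply, smul_eq_mul, W, Matrix.of_apply, Matrix.cons_val',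
            Matrix.cons_val_zero, Matrix.cons_val_one, Matrix.empty_val', Matrix.cons_val_fin_one]
        have hsymT : (∑ l, Real.exp (δ l * τ j) • T l) 1 0 = (∑ l, Real.exp (δ l * τ j) • T l) 0 1 := by
          rw [hevalT, Matrix.add_apply, Matrix.add_apply, Matrix.smul_apply, Matrix.smul_apply, hsym0, hsym']
        rw [det_add_sub_sub_eq _ _ hsymT]
        have e0 := det_add_sub_sub_eq (P j) _ hsym0
        have e' := det_add_sub_sub_eq (P j) _ hsym'
        have hb : bj j = κ j * ((P j) 1 1 * (∑ l, Real.exp (δ l * τ j) • T₀ l) 0 0 -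
            ((P j) 0 1 + (P j) 1 0) * (∑ l, Real.exp (δ l * τ j) • T₀ l) 0 1 +
            (P j) 0 0 * (∑ l, Real.exp (δ l * τ j) • T₀ l) 1 1) := by simp only [bj]; rw [e0]
        have ha : aj j = κ j * ((P j) 1 1 * (∑ l, Real.exp (δ l * τ j) • T' l) 0 0 -
            ((P j) 0 1 + (P j) 1 0) * (∑ l, Real.exp (δ l * τ j) • T' l) 0 1 +
            (P j) 0 0 * (∑ l, Real.exp (δ l * τ j) • T' l) 1 1) := by
          simp only [aj, dif_pos hjr]; rw [← hT'push j hjr, e']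
        have := hlam_big j
        rw [hb, ha] at this
        rw [hevalT]
        simp only [Matrix.add_apply, Matrix.smul_apply, smul_eq_mul]
        have key : κ j * ((P j) 1 1 * ((∑ l, Real.exp (δ l * τ j) • T₀ l) 0 0 + lam * (∑ l, Real.exp (δ l * τ j) • T' l) 0 0) -
            ((P j) 0 1 + (P j) 1 0) * ((∑ l, Real.exp (δ l * τ j) • T₀ l) 0 1 + lam * (∑ l, Real.exp (δ l * τ j) • T' l) 0 1) +
            (P j) 0 0 * ((∑ l, Real.exp (δ l * τ j) • T₀ l) 1 1 + lam * (∑ l, Real.exp (δ l * τ j) • T' l) 1 1)) =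
            κ j * ((P j) 1 1 * (∑ l, Real.exp (δ l * τ j) • T₀ l) 0 0 -
            ((P j) 0 1 + (P j) 1 0) * (∑ l, Real.exp (δ l * τ j) • T₀ l) 0 1 +
            (P j) 0 0 * (∑ l, Real.exp (δ l * τ j) • T₀ l) 1 1) + lam * (κ j * ((P j) 1 1 * (∑ l, Real.exp (δ l * τ j) • T' l) 0 0 -
            ((P j) 0 1 + (P j) 1 0) * (∑ l, Real.exp (δ l * τ j) • T' l) 0 1 +
            (P j) 0 0 * (∑ l, Real.exp (δ l * τ j) • T' l) 1 1)) := by ring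
        rw [key]; exact this
    · exact Or.inl (hoff j hjJ)
  · -- BALANCED: excluded by `noRestrictedBalance`
    exfalso
    let μ' : Fin 21 → ℝ := fun j => if hj : j ∈ Jr then μ ⟨j, hj⟩ else 0
    have hμ'J : ∀ j : Jr, μ' j = μ j := fun j => by simp only [μ', dif_pos j.2]
    have hrestrict : ∀ g : Fin 21 → ℝ, (∑ j, μ' j * g j) = ∑ j : Jr, μ j * g j := by
      intro g
      have h1 : (∑ j, μ' j * g j) = ∑ j ∈ Jr, μ' j * g j := by
        rw [← Finset.sum_subset (Finset.subset_univ Jr)]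
        intro j _ hj
        simp only [μ', dif_neg hj, zero_mul]
      rw [h1, ← Finset.sum_coe_sort Jr (fun j => μ' j * g j)]
      exact Finset.sum_congr rfl fun j _ => by rw [hμ'J j]
    have hz := noRestrictedBalance δ hd S hS τ hτ κ J J₀ hJ₀ hoff hon hnode halt h0 h20 hsep μ'
      (fun j => by simp only [μ']; split_ifs; exacts [hμ0 _, le_rfl])
      (fun j hj => by simp only [μ']; rw [dif_neg (fun h => hj ((hmemJr j).1 h).1)])
      (fun j hj => by simp only [μ']; rw [dif_neg (fun h => ((hmemJr j).1 h).2 hj)]) ?_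
    · have h1 : (∑ j : Jr, μ j) = 0 := by
        rw [Finset.sum_congr rfl (fun (j : Jr) _ => (hμ'J j).symm)]; simp [hz]
      linarith
    · -- the restricted balance in test form
      intro c hc β
      -- expand `φ_c` on the interpolants: `φ_c(x) = Σ_m φ_c(t_m) φ_m(x)` (both sides agree at the six nodes)
      have hexp : ∀ x, ∑ l, c l * Real.exp (δ l * x) = ∑ m, (∑ l, c l * Real.exp (δ l * t m)) * ∑ l, C m l * Real.exp (δ l * x) := by
        -- coefficients agree: the difference vanishes at the six nodes `t`
        have hstep : ∀ i, ∑ l, (∑ m, (∑ l', c l' * Real.exp (δ l' * t m)) * C m l) * Real.exp (δ l * t i) =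
            ∑ l', c l' * Real.exp (δ l' * t i) := by
          intro i
          calc ∑ l, (∑ m, (∑ l', c l' * Real.exp (δ l' * t m)) * C m l) * Real.exp (δ l * t i)
              = ∑ l, ∑ m, (∑ l', c l' * Real.exp (δ l' * t m)) * (C m l * Real.exp (δ l * t i)) := by
                refine Finset.sum_congr rfl fun l _ => ?_
                rw [Finset.sum_mul]; exact Finset.sum_congr rfl fun m _ => by ring
            _ = ∑ m, (∑ l', c l' * Real.exp (δ l' * t m)) * ∑ l, C m l * Real.exp (δ l * t i) := by
                rw [Finset.sum_comm]; exact Finset.sum_congr rfl fun m _ => by rw [Finset.mul_sum]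
            _ = ∑ m, (∑ l', c l' * Real.exp (δ l' * t m)) * (if i = m then 1 else 0) := by
                exact Finset.sum_congr rfl fun m _ => by rw [hCval m i]
            _ = ∑ l', c l' * Real.exp (δ l' * t i) := by simp [mul_ite, Finset.sum_ite_eq]
        have hcoef : (fun l => c l - ∑ m, (∑ l', c l' * Real.exp (δ l' * t m)) * C m l) = 0 := by
          refine expCoeff_eq_zero_of_zeros δ hd.injective t htinj _ (fun i => ?_)
          simp only [sub_mul, Finset.sum_sub_distrib, hstep i, sub_self]
        intro x
        have := congrFun hcoef
        simp only [Pi.zero_apply, sub_eq_zero] at this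
        calc ∑ l, c l * Real.exp (δ l * x) = ∑ l, (∑ m, (∑ l', c l' * Real.exp (δ l' * t m)) * C m l) * Real.exp (δ l * x) :=
              Finset.sum_congr rfl fun l _ => by rw [← this l]
          _ = ∑ m, (∑ l', c l' * Real.exp (δ l' * t m)) * ∑ l, C m l * Real.exp (δ l * x) := by
              simp only [Finset.sum_mul, Finset.mul_sum]
              rw [Finset.sum_comm]
              exact Finset.sum_congr rfl fun m _ => Finset.sum_congr rfl fun l _ => by
                simp only [mul_assoc, mul_comm, mul_left_comm]
      -- node coefficients vanish
      have hcnode : ∀ m, e6 m ∈ J₀ → ∑ l', c l' * Real.exp (δ l' * t m) = 0 := fun m hm => hc _ hm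
      -- polar in push coordinates
      have hpol : ∀ j, polar β (P j) = (1/2) * (β 0 0 * c3 j 0 + ((β 0 1 + β 1 0) / 2) * c3 j 1 + β 1 1 * c3 j 2) := by
        intro j
        rw [polar_apply]
        simp only [c3, Matrix.cons_val_zero, Matrix.cons_val_one, Matrix.cons_val_two, Matrix.head_cons,
          Matrix.tail_cons, hPsym j]
        ring
      -- the three coordinate balances from Gordan
      have hcoord : ∀ m, e6 m ∉ J₀ → ∀ e : Fin 3,
          ∑ j : Jr, μ j * (κ j * (∑ l, C m l * Real.exp (δ l * τ j)) * c3 j e) = 0 := by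
        intro m hm e
        rw [← hμV (m, e)]
        exact Finset.sum_congr rfl fun j _ => by simp only [V, if_neg hm]
      -- assemble: E(m,e) = Σ_j μ'_j κ_j φ_m(τ_j) c3_j(e) vanishes against φ_c(t_m)
      set A : Fin 6 → ℝ := fun m => ∑ l', c l' * Real.exp (δ l' * t m) with hA
      set E : Fin 6 → Fin 3 → ℝ := fun m e => ∑ j, μ' j * (κ j * (∑ l, C m l * Real.exp (δ l * τ j)) * c3 j e) with hE
      have hAE : ∀ m e, A m * E m e = 0 := by
        intro m e
        by_cases hm : e6 m ∈ J₀
        · rw [show A m = 0 from hcnode m hm, zero_mul]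
        · rw [show E m e = 0 from by rw [hE]; simp only; rw [hrestrict]; exact hcoord m hm e, mul_zero]
      set w0 := β 0 0 with hw0
      set w1 := (β 0 1 + β 1 0) / 2 with hw1
      set w2 := β 1 1 with hw2
      calc ∑ j, μ' j * κ j * polar β (P j) * ∑ l, c l * Real.exp (δ l * τ j)
          = ∑ j, ∑ m, (1/2) * A m * (μ' j * (w0 * (κ j * (∑ l, C m l * Real.exp (δ l * τ j)) * c3 j 0) +
              w1 * (κ j * (∑ l, C m l * Real.exp (δ l * τ j)) * c3 j 1) +
              w2 * (κ j * (∑ l, C m l * Real.exp (δ l * τ j)) * c3 j 2))) := by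
            refine Finset.sum_congr rfl fun j _ => ?_
            rw [hpol j, hexp (τ j), Finset.mul_sum]
            exact Finset.sum_congr rfl fun m _ => by simp only [hA]; ring
        _ = ∑ m, ∑ j, (1/2) * A m * (μ' j * (w0 * (κ j * (∑ l, C m l * Real.exp (δ l * τ j)) * c3 j 0) +
              w1 * (κ j * (∑ l, C m l * Real.exp (δ l * τ j)) * c3 j 1) +
              w2 * (κ j * (∑ l, C m l * Real.exp (δ l * τ j)) * c3 j 2))) := Finset.sum_comm
        _ = ∑ m, (1/2) * (w0 * (A m * E m 0) + w1 * (A m * E m 1) + w2 * (A m * E m 2)) := by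
            refine Finset.sum_congr rfl fun m _ => ?_
            simp only [hE, Finset.mul_sum, ← Finset.sum_add_distrib]
            exact Finset.sum_congr rfl fun j _ => by ring
        _ = 0 := by simp [hAE]

end Summit.ValiantsHypothesis.ValiantsHypothesis.Theorems.LacunarySymmetroidMatrixDescartes.WallBubbling
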